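import Literature.Analysis.FluidPDE.Seregin2020SwirlEnergyInequality
import Literature.Analysis.FluidPDE.ParabolicTenThirds
import HarnessLib

/-!
# Seregin 2020, proof of Thm. 2.1: the energy class bound and the `L^{10/3}` step of the Moser iteration

Analysis/FluidPDE proofs file (theorems only; no definitions, no named facts), on the discharge
path of the named fact `Literature.Analysis.FluidPDE.Seregin2020_axisymmetricSingularPoint_typeII`
(G. Seregin, *Local regularity of axisymmetric solutions to the Navier–Stokes equations*, Anal.
Math. Phys. 10 (2020), Paper No. 46 = arXiv:2006.04140, Thm. 2.1).

After the energy inequality (arXiv p. 5) the printed proof passes to "the basic estimate" (2.3)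
`|ψ²ω_N|²_{2,Q} := sup_t ‖ψ²ω_N‖²_{L₂} + ‖∇(ψ²ω_N)‖²_{L₂(Q)} ≤ …` and then uses "the known
multiplicative inequality `‖ψ²ω_N‖_{L_{10/3}(Q(r₁))} ≤ c|ψ²ω_N|_{2,Q(r₁)}`" (2.4). This file proves
these two steps for the tree's form of the argument (energy inequality
`Seregin2020.swirl_energy_inequality`; energy-class function `g = χ(t) Θ(x) s(σ)` with `H = s²`,
`2s'² ≤ H''`, `η = χ²`):

* `Seregin2020.swirl_moser_energyClass_bounds` — for every `t ∈ [t₁, hi[`,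
  `η(t) M(t) ≤ ℛ` and `½ ∫_{t₁}^t η G_H ≤ ℛ`, where
  `ℛ = ∫⁻_{]t₁,hi[} (4ηP + ηP_V + ηB_b + |η'|M)` (in `[0, ∞]`) is the space–time integral of the
  nonnegative majorants of the right-hand side of the energy inequality
  (`T_V ≤ P_V = ∫H(σ)|V|‖∇Θ²‖`, `T_b ≤ B_b = ∫(2/ϱ)H(σ)(∂_ϱΘ²)⁺`);
* `Seregin2020.swirl_moser_tenThirds_le` — the multiplicative inequality (2.4) in the form
  `∬_{]t₁,hi[×ℝ³} |χΘ s(σ)|^{10/3} ≤ C_S² ℛ^{2/3} · (5/2) ℛ` (the tree's parabolic embedding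
  `LeiZhang2011.lintegral_rpow_tenThirds_le_of_slice_bounds`, fed with the slice bounds
  `‖g(t)‖₂² = η M ≤ ℛ`, `‖∇g(t)‖₂² ≤ η(G_H + 2P)`, `∫ηG_H ≤ 2ℛ`, `∫4ηP ≤ ℛ`).

## References

* G. Seregin, Anal. Math. Phys. 10 (2020), Paper 46 = arXiv:2006.04140, proof of Thm. 2.1,
  (2.3)–(2.4) (arXiv pp. 5–6). [`Seregin2020`]
* Z. Lei, Q. S. Zhang, J. Funct. Anal. 261 (2011) = arXiv:1011.5066, §2 (2.4)–(2.5) p. 7.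
  [`LeiZhang2011`]
-/

noncomputable section

open MeasureTheory Set Function Filter Topology TopologicalSpace Metric WithLp intervalIntegral
open scoped NNReal ENNReal ContDiff InnerProductSpace RealInnerProductSpace Laplacian

namespace Literature.Analysis.FluidPDE

namespace Seregin2020

open SereginZajaczkowski2007 SereginSverak2009 LeiZhang2011

variable {V : ℝ → EuclideanSpace ℝ (Fin 3) → EuclideanSpace ℝ (Fin 3)} {P : ℝ → EuclideanSpace ℝ (Fin 3) → ℝ}
  {S : Opens (ℝ × EuclideanSpace ℝ (Fin 3))} {lo hi : ℝ} {U : Set (EuclideanSpace ℝ (Fin 3))}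

/-! ### A pointwise gradient bound for `Θ · s(F)` -/

/-- **`‖D(Θ · s∘F)‖² ≤ G(F)‖∇F‖²Θ² + 2 s(F)²‖∇Θ‖²`** at a point where `F` and `Θ` are
differentiable, for `s ∈ C¹` with `2 s'² ≤ G` (the tree's `LeiZhang2011.norm_gradient_mul_comp_sq_le'`,
pointwise). [cite: LeiZhang2011, §2 (arXiv p. 7), Sobolev step of the Moser iteration] -/
theorem norm_fderiv_mul_comp_sq_le_at {F Θ : EuclideanSpace ℝ (Fin 3) → ℝ} {x : EuclideanSpace ℝ (Fin 3)}
    (hF : DifferentiableAt ℝ F x) (hΘ : DifferentiableAt ℝ Θ x) {sf Gf : ℝ → ℝ}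
    (hsf : ContDiff ℝ 1 sf) (hsG : ∀ v, 2 * deriv sf v ^ 2 ≤ Gf v) :
    ‖fderiv ℝ (fun y => Θ y * sf (F y)) x‖ ^ 2 ≤
      Gf (F x) * ‖gradient F x‖ ^ 2 * Θ x ^ 2 + 2 * sf (F x) ^ 2 * ‖gradient Θ x‖ ^ 2 := by
  have hsd : DifferentiableAt ℝ sf (F x) := (hsf.differentiable one_ne_zero) (F x)
  have hsF : DifferentiableAt ℝ (fun y => sf (F y)) x := hsd.comp x hF
  have hcomp : fderiv ℝ (fun y => sf (F y)) x = deriv sf (F x) • fderiv ℝ F x :=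
    (hsd.hasDerivAt.comp_hasFDerivAt x hF.hasFDerivAt).fderiv
  have hprod : fderiv ℝ (fun y => Θ y * sf (F y)) x =
      Θ x • (deriv sf (F x) • fderiv ℝ F x) + sf (F x) • fderiv ℝ Θ x := by
    rw [fderiv_fun_mul hΘ hsF, hcomp]
  rw [hprod]
  have hnF : ‖fderiv ℝ F x‖ = ‖gradient F x‖ := by rw [gradient, LinearIsometryEquiv.norm_map]
  have hnΘ : ‖fderiv ℝ Θ x‖ = ‖gradient Θ x‖ := by rw [gradient, LinearIsometryEquiv.norm_map]
  have h1 : ‖Θ x • (deriv sf (F x) • fderiv ℝ F x) + sf (F x) • fderiv ℝ Θ x‖ ≤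
      |Θ x| * |deriv sf (F x)| * ‖gradient F x‖ + |sf (F x)| * ‖gradient Θ x‖ := by
    refine (norm_add_le _ _).trans (le_of_eq ?_)
    rw [norm_smul, norm_smul, norm_smul, Real.norm_eq_abs, Real.norm_eq_abs, Real.norm_eq_abs, hnF, hnΘ]
    ring
  have h0 : 0 ≤ |Θ x| * |deriv sf (F x)| * ‖gradient F x‖ + |sf (F x)| * ‖gradient Θ x‖ := by positivity
  have h2 : ‖Θ x • (deriv sf (F x) • fderiv ℝ F x) + sf (F x) • fderiv ℝ Θ x‖ ^ 2 ≤
      (|Θ x| * |deriv sf (F x)| * ‖gradient F x‖ + |sf (F x)| * ‖gradient Θ x‖) ^ 2 :=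
    pow_le_pow_left₀ (norm_nonneg _) h1 2
  have h3 : (|Θ x| * |deriv sf (F x)| * ‖gradient F x‖ + |sf (F x)| * ‖gradient Θ x‖) ^ 2 ≤
      2 * (|Θ x| * |deriv sf (F x)| * ‖gradient F x‖) ^ 2 + 2 * (|sf (F x)| * ‖gradient Θ x‖) ^ 2 := by
    nlinarith [sq_nonneg (|Θ x| * |deriv sf (F x)| * ‖gradient F x‖ - |sf (F x)| * ‖gradient Θ x‖)]
  have h4 : 2 * (|Θ x| * |deriv sf (F x)| * ‖gradient F x‖) ^ 2 ≤ Gf (F x) * ‖gradient F x‖ ^ 2 * Θ x ^ 2 := by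
    have e : 2 * (|Θ x| * |deriv sf (F x)| * ‖gradient F x‖) ^ 2 =
        (2 * deriv sf (F x) ^ 2) * (‖gradient F x‖ ^ 2 * Θ x ^ 2) := by
      rw [mul_pow, mul_pow, sq_abs, sq_abs]
      ring
    rw [e]
    calc (2 * deriv sf (F x) ^ 2) * (‖gradient F x‖ ^ 2 * Θ x ^ 2)
        ≤ Gf (F x) * (‖gradient F x‖ ^ 2 * Θ x ^ 2) := mul_le_mul_of_nonneg_right (hsG _) (by positivity)
      _ = _ := by ring
  have h5 : 2 * (|sf (F x)| * ‖gradient Θ x‖) ^ 2 = 2 * sf (F x) ^ 2 * ‖gradient Θ x‖ ^ 2 := by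
    rw [mul_pow, sq_abs]
    ring
  linarith [h2, h3, h4, h5]

/-! ### Nonnegative majorants of the transport terms -/

/-- `T_V = ∫ H(σ)⟪V, ∇Θ²⟫ ≤ P_V = ∫ H(σ)‖V‖‖∇Θ²‖` pointwise (`H ≥ 0`). [folklore] -/
theorem transport_integrand_le {H : ℝ → ℝ} (hH0 : ∀ v, 0 ≤ H v) (σ : ℝ) (v w : EuclideanSpace ℝ (Fin 3)) :
    H σ * ⟪v, w⟫ ≤ H σ * (‖v‖ * ‖w‖) :=
  mul_le_mul_of_nonneg_left ((le_abs_self _).trans (abs_real_inner_le_norm v w)) (hH0 σ)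

/-- `(2/ϱ) H(σ) D(Θ²)[e_ϱ] ≤ (2/ϱ) H(σ) (D(Θ²)[e_ϱ])⁺` pointwise (`H ≥ 0`, `ϱ ≥ 0`). [folklore] -/
theorem drift_integrand_le {H : ℝ → ℝ} (hH0 : ∀ v, 0 ≤ H v) (σ d : ℝ) (x : EuclideanSpace ℝ (Fin 3)) :
    2 / cylRadius x * (H σ * d) ≤ 2 / cylRadius x * (H σ * max d 0) :=
  mul_le_mul_of_nonneg_left (mul_le_mul_of_nonneg_left (le_max_left _ _) (hH0 σ))
    (div_nonneg zero_le_two (cylRadius_nonneg x))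

/-! ### The energy class bound -/

/-- **The energy class bound of the Moser step** (Seregin 2020, (2.3): the left-hand side
`sup_t ‖ψ²ω_N(t)‖²₂ + ‖∇(ψ²ω_N)‖²_{L₂(Q)}` is bounded by the right-hand side of the energy
inequality). In the setting of `swirl_energy_inequality` (`S = ]lo, hi[ × U` rotation invariant,
`U` open off the axis; `H ∈ C²`, `H, H'' ≥ 0`, `H'² ≤ 2HH''`; `Θ ∈ C¹_c`, `tsupport Θ ⊆ U`;
`η ∈ C¹`, `η ≥ 0`, `η(t₁) = 0`, `lo < t₁ < hi`), let
`ℛ = ∫⁻_{]t₁, hi[} (4ηP + ηP_V + ηB_b + |η'|M) ∈ [0, ∞]` with `P_V = ∫H(σ)‖V‖‖∇Θ²‖`,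
`B_b = ∫(2/ϱ)H(σ)(∂_ϱΘ²)⁺` the nonnegative majorants of the transport terms. Then for every
`t ∈ [t₁, hi[`: `η(t)M(t) ≤ ℛ` and `½∫_{t₁}^t ηG_H ≤ ℛ` (as extended nonnegative reals).
[cite: Seregin2020, proof of Thm. 2.1, (2.3) (arXiv p. 5)] -/
theorem swirl_moser_energyClass_bounds (hU : IsOpen U)
    (hSU : (S : Set (ℝ × EuclideanSpace ℝ (Fin 3))) = Ioo lo hi ×ˢ U)
    (hS : ∀ θ : ℝ, ∀ z ∈ (S : Set (ℝ × EuclideanSpace ℝ (Fin 3))), stRot θ z ∈ (S : Set (ℝ × EuclideanSpace ℝ (Fin 3))))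
    (hUρ : ∀ x ∈ U, cylRadius x ≠ 0) (hV : IsSmoothAxisymmetricSolutionOn S V P)
    {H : ℝ → ℝ} (hH : ContDiff ℝ 2 H) (hH0 : ∀ v, 0 ≤ H v) (hH2 : ∀ v, 0 ≤ deriv (deriv H) v)
    (hκ : ∀ v, deriv H v ^ 2 ≤ 2 * H v * deriv (deriv H) v)
    {Θ : EuclideanSpace ℝ (Fin 3) → ℝ} (hΘ : ContDiff ℝ 1 Θ) (hΘc : HasCompactSupport Θ)
    (hΘU : tsupport Θ ⊆ U) {η : ℝ → ℝ} (hη : ContDiff ℝ 1 η) (hη0 : ∀ s, 0 ≤ η s)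
    {t₁ : ℝ} (h1 : lo < t₁) (hη1 : η t₁ = 0)
    {M GH Pf PV Bb : ℝ → ℝ}
    (hM : ∀ s, M s = ∫ x, H (swirl (V s) x) * Θ x ^ 2)
    (hGH : ∀ s, GH s = ∫ x, deriv (deriv H) (swirl (V s) x) * ‖gradient (swirl (V s)) x‖ ^ 2 * Θ x ^ 2)
    (hPf : ∀ s, Pf s = ∫ x, H (swirl (V s) x) * ‖gradient Θ x‖ ^ 2)
    (hPV : ∀ s, PV s = ∫ x, H (swirl (V s) x) * (‖V s x‖ * ‖gradient (fun y => Θ y ^ 2) x‖))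
    (hBb : ∀ s, Bb s = ∫ x, 2 / cylRadius x * (H (swirl (V s) x) * max (fderiv ℝ (fun y => Θ y ^ 2) x (eR x)) 0))
    {t : ℝ} (h1t : t₁ ≤ t) (ht : t < hi) :
    ENNReal.ofReal (η t * M t) ≤
        ∫⁻ s in Ioo t₁ hi, ENNReal.ofReal (4 * (η s * Pf s) + η s * PV s + η s * Bb s + |deriv η s| * M s) ∧
      ENNReal.ofReal (1 / 2 * ∫ s in t₁..t, η s * GH s) ≤
        ∫⁻ s in Ioo t₁ hi, ENNReal.ofReal (4 * (η s * Pf s) + η s * PV s + η s * Bb s + |deriv η s| * M s) := by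
  -- the signed transport terms
  obtain ⟨TV, hTV⟩ : ∃ TV : ℝ → ℝ, ∀ s, TV s = ∫ x, H (swirl (V s) x) * ⟪V s x, gradient (fun y => Θ y ^ 2) x⟫ :=
    ⟨_, fun _ => rfl⟩
  obtain ⟨Tb, hTb⟩ : ∃ Tb : ℝ → ℝ, ∀ s, Tb s =
      ∫ x, 2 / cylRadius x * (H (swirl (V s) x) * fderiv ℝ (fun y => Θ y ^ 2) x (eR x)) := ⟨_, fun _ => rfl⟩
  obtain ⟨T₁, hT₁⟩ : ∃ T₁ : ℝ → ℝ, ∀ s, T₁ s = ∫ x, deriv H (swirl (V s) x) *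
      ⟪gradient (swirl (V s)) x, gradient (fun y => Θ y ^ 2) x⟫ := ⟨_, fun _ => rfl⟩
  have hEI := swirl_energy_inequality hU hSU hS hUρ hV hH hH0 hH2 hκ hΘ hΘc hΘU hη hη0 h1 h1t ht hη1
    hM hGH hPf hTV hTb
  obtain ⟨cM, cGH, -, cPf, cTV, cTb⟩ :=
    continuousOn_swirl_sliceFunctionals hU hSU hUρ hV hH hΘ hΘc hΘU hM hGH hT₁ hPf hTV hTb
  -- continuity of the majorants `PV`, `Bb`
  set K : Set (EuclideanSpace ℝ (Fin 3)) := tsupport Θ with hKdef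
  have hK : IsCompact K := hΘc
  have hΘ0 : ∀ x, x ∉ K → Θ x = 0 := fun x hx => image_eq_zero_of_notMem_tsupport hx
  have hgΘ0 : ∀ x, x ∉ K → gradient (fun y => Θ y ^ 2) x = 0 := fun x hx => gradient_sq_eq_zero_of_notMem hx
  have hfΘ0 : ∀ x, x ∉ K → fderiv ℝ (fun y => Θ y ^ 2) x = 0 := fun x hx => fderiv_sq_eq_zero_of_notMem hx
  have hρS : ∀ z ∈ (S : Set (ℝ × EuclideanSpace ℝ (Fin 3))), cylRadius z.2 ≠ 0 := by
    intro z hz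
    rw [hSU] at hz
    exact hUρ z.2 hz.2
  have hΘ2 : ContDiff ℝ 1 fun y => Θ y ^ 2 := hΘ.pow 2
  have cσ : ContinuousOn (fun z : ℝ × EuclideanSpace ℝ (Fin 3) => swirl (V z.1) z.2)
      (S : Set (ℝ × EuclideanSpace ℝ (Fin 3))) := hV.continuousOn_swirl
  have cHσ : ContinuousOn (fun z : ℝ × EuclideanSpace ℝ (Fin 3) => H (swirl (V z.1) z.2))
      (S : Set (ℝ × EuclideanSpace ℝ (Fin 3))) := hH.continuous.comp_continuousOn cσ
  have cVn : ContinuousOn (fun z : ℝ × EuclideanSpace ℝ (Fin 3) => ‖V z.1 z.2‖) (S : Set (ℝ × EuclideanSpace ℝ (Fin 3))) :=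
    hV.continuousOn_velocity.norm
  have cgΘ2 : Continuous fun z : ℝ × EuclideanSpace ℝ (Fin 3) => ‖gradient (fun y => Θ y ^ 2) z.2‖ :=
    ((continuous_gradient_of_contDiff hΘ2).comp continuous_snd).norm
  have cfΘ2 : Continuous fun z : ℝ × EuclideanSpace ℝ (Fin 3) => fderiv ℝ (fun y => Θ y ^ 2) z.2 :=
    (hΘ2.continuous_fderiv one_ne_zero).comp continuous_snd
  have ceR : ContinuousOn (fun z : ℝ × EuclideanSpace ℝ (Fin 3) => eR z.2) (S : Set (ℝ × EuclideanSpace ℝ (Fin 3))) :=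
    continuousOn_eR_offAxis.comp continuous_snd.continuousOn fun z hz => hρS z hz
  have cinv : ContinuousOn (fun z : ℝ × EuclideanSpace ℝ (Fin 3) => 2 / cylRadius z.2) (S : Set (ℝ × EuclideanSpace ℝ (Fin 3))) :=
    continuousOn_const.div (continuous_cylRadius.comp continuous_snd).continuousOn hρS
  have hSU' : (S : Set (ℝ × EuclideanSpace ℝ (Fin 3))) = Ioo lo hi ×ˢ U := hSU
  have cPV : ContinuousOn PV (Ioo lo hi) := by
    have h := continuousOn_integral_slice_of_eq_zero (I := Ioo lo hi) hU hK hΘU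
      (Φ := fun z : ℝ × EuclideanSpace ℝ (Fin 3) => H (swirl (V z.1) z.2) * (‖V z.1 z.2‖ * ‖gradient (fun y => Θ y ^ 2) z.2‖))
      (by rw [← hSU']; exact cHσ.mul (cVn.mul cgΘ2.continuousOn)) (fun s x hx => by simp [hgΘ0 x hx])
    exact h.congr fun s _ => hPV s
  have cBb : ContinuousOn Bb (Ioo lo hi) := by
    have h := continuousOn_integral_slice_of_eq_zero (I := Ioo lo hi) hU hK hΘU
      (Φ := fun z : ℝ × EuclideanSpace ℝ (Fin 3) =>
        2 / cylRadius z.2 * (H (swirl (V z.1) z.2) * max (fderiv ℝ (fun y => Θ y ^ 2) z.2 (eR z.2)) 0))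
      (by
        rw [← hSU']
        exact cinv.mul (cHσ.mul (ContinuousOn.sup (cfΘ2.continuousOn.clm_apply ceR) continuousOn_const)))
      (fun s x hx => by simp [hfΘ0 x hx])
    exact h.congr fun s _ => hBb s
  -- the transport terms are dominated by their majorants, slice by slice
  have hdom : ∀ s ∈ Icc t₁ t, TV s ≤ PV s ∧ Tb s ≤ Bb s := by
    intro s hs
    have hsI : s ∈ Ioo lo hi := ⟨lt_of_lt_of_le h1 hs.1, lt_of_le_of_lt hs.2 ht⟩
    have cF : ContinuousOn (swirl (V s)) U := (contDiffOn_swirl_slice hSU hV hsI).continuousOn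
    have cHF : ContinuousOn (fun x => H (swirl (V s) x)) U := hH.continuous.comp_continuousOn cF
    have cVs : ContinuousOn (V s) U := (contDiffOn_velocity_slice hSU hV hsI).continuousOn
    have cg2 : Continuous (gradient fun y => Θ y ^ 2) := continuous_gradient_of_contDiff hΘ2
    have cf2 : Continuous (fderiv ℝ fun y => Θ y ^ 2) := hΘ2.continuous_fderiv one_ne_zero
    have ceRU : ContinuousOn eR U := continuousOn_eR_offAxis.mono fun x hx => hUρ x hx
    have cinvU : ContinuousOn (fun x => 2 / cylRadius x) U :=
      continuousOn_const.div continuous_cylRadius.continuousOn fun x hx => hUρ x hx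
    have iTV : Integrable fun x => H (swirl (V s) x) * ⟪V s x, gradient (fun y => Θ y ^ 2) x⟫ :=
      (continuous_integrable_of_continuousOn_of_eq_zero hU hK hΘU (cHF.mul (cVs.inner cg2.continuousOn))
        (fun x hx => by
          show H (swirl (V s) x) * ⟪V s x, gradient (fun y => Θ y ^ 2) x⟫ = 0
          rw [hgΘ0 x hx, inner_zero_right, mul_zero])).2
    have iPV : Integrable fun x => H (swirl (V s) x) * (‖V s x‖ * ‖gradient (fun y => Θ y ^ 2) x‖) :=
      (continuous_integrable_of_continuousOn_of_eq_zero hU hK hΘU (cHF.mul (cVs.norm.mul cg2.norm.continuousOn))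
        (fun x hx => by simp [hgΘ0 x hx])).2
    have iTb : Integrable fun x => 2 / cylRadius x * (H (swirl (V s) x) * fderiv ℝ (fun y => Θ y ^ 2) x (eR x)) :=
      (continuous_integrable_of_continuousOn_of_eq_zero hU hK hΘU
        (cinvU.mul (cHF.mul (cf2.continuousOn.clm_apply ceRU))) (fun x hx => by simp [hfΘ0 x hx])).2
    have iBb : Integrable fun x => 2 / cylRadius x * (H (swirl (V s) x) * max (fderiv ℝ (fun y => Θ y ^ 2) x (eR x)) 0) :=
      (continuous_integrable_of_continuousOn_of_eq_zero hU hK hΘU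
        (cinvU.mul (cHF.mul (ContinuousOn.sup (cf2.continuousOn.clm_apply ceRU) continuousOn_const)))
        (fun x hx => by simp [hfΘ0 x hx])).2
    refine ⟨?_, ?_⟩
    · rw [hTV s, hPV s]
      exact integral_mono iTV iPV fun x => transport_integrand_le hH0 _ _ _
    · rw [hTb s, hBb s]
      exact integral_mono iTb iBb fun x => drift_integrand_le hH0 _ _ x
  -- interval integrability on `[t₁, t]`
  have hIcc : Icc t₁ t ⊆ Ioo lo hi := fun r hr => ⟨lt_of_lt_of_le h1 hr.1, lt_of_le_of_lt hr.2 ht⟩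
  have hsub : uIcc t₁ t ⊆ Ioo lo hi := by
    rw [uIcc_of_le h1t]
    exact hIcc
  have cη : Continuous η := hη.continuous
  have cη' : Continuous (deriv η) := hη.continuous_deriv le_rfl
  have iiη : ∀ {f : ℝ → ℝ}, IntervalIntegrable f volume t₁ t → IntervalIntegrable (fun s => η s * f s) volume t₁ t :=
    fun hf => hf.continuousOn_mul cη.continuousOn
  have iiM : IntervalIntegrable M volume t₁ t := (cM.mono hsub).intervalIntegrable
  have iiGH : IntervalIntegrable GH volume t₁ t := (cGH.mono hsub).intervalIntegrable
  have iiPf : IntervalIntegrable Pf volume t₁ t := (cPf.mono hsub).intervalIntegrable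
  have iiTV : IntervalIntegrable TV volume t₁ t := (cTV.mono hsub).intervalIntegrable
  have iiTb : IntervalIntegrable Tb volume t₁ t := (cTb.mono hsub).intervalIntegrable
  have iiPV : IntervalIntegrable PV volume t₁ t := (cPV.mono hsub).intervalIntegrable
  have iiBb : IntervalIntegrable Bb volume t₁ t := (cBb.mono hsub).intervalIntegrable
  have iR₁ : IntervalIntegrable (fun s => 4 * (η s * Pf s) + η s * TV s + η s * Tb s + |deriv η s| * M s) volume t₁ t :=
    ((((iiη iiPf).const_mul 4).add (iiη iiTV)).add (iiη iiTb)).add (iiM.continuousOn_mul cη'.abs.continuousOn)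
  have iR₂ : IntervalIntegrable (fun s => 4 * (η s * Pf s) + η s * PV s + η s * Bb s + |deriv η s| * M s) volume t₁ t :=
    ((((iiη iiPf).const_mul 4).add (iiη iiPV)).add (iiη iiBb)).add (iiM.continuousOn_mul cη'.abs.continuousOn)
  -- the right-hand side of the energy inequality is at most `∫_{t₁}^t R₂ ≤ ℛ`
  have hR12 : ∫ s in t₁..t, (4 * (η s * Pf s) + η s * TV s + η s * Tb s + |deriv η s| * M s) ≤
      ∫ s in t₁..t, (4 * (η s * Pf s) + η s * PV s + η s * Bb s + |deriv η s| * M s) := by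
    refine intervalIntegral.integral_mono_on h1t iR₁ iR₂ fun s hs => ?_
    obtain ⟨hTV', hTb'⟩ := hdom s hs
    have h1' := mul_le_mul_of_nonneg_left hTV' (hη0 s)
    have h2' := mul_le_mul_of_nonneg_left hTb' (hη0 s)
    linarith
  have hR₂nn : ∀ s ∈ Icc t₁ t, 0 ≤ 4 * (η s * Pf s) + η s * PV s + η s * Bb s + |deriv η s| * M s := by
    intro s hs
    have hsI : s ∈ Ioo lo hi := hIcc hs
    have hPf0 : 0 ≤ Pf s := by
      rw [hPf s]
      exact integral_nonneg fun x => mul_nonneg (hH0 _) (sq_nonneg _)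
    have hPV0 : 0 ≤ PV s := by
      rw [hPV s]
      exact integral_nonneg fun x => mul_nonneg (hH0 _) (mul_nonneg (norm_nonneg _) (norm_nonneg _))
    have hBb0 : 0 ≤ Bb s := by
      rw [hBb s]
      exact integral_nonneg fun x => mul_nonneg (div_nonneg zero_le_two (cylRadius_nonneg x))
        (mul_nonneg (hH0 _) (le_max_right _ _))
    have hM0 : 0 ≤ M s := by
      rw [hM s]
      exact integral_nonneg fun x => mul_nonneg (hH0 _) (sq_nonneg _)
    have := hη0 s
    positivity
  have hR₂le : ENNReal.ofReal (∫ s in t₁..t, (4 * (η s * Pf s) + η s * PV s + η s * Bb s + |deriv η s| * M s)) ≤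
      ∫⁻ s in Ioo t₁ hi, ENNReal.ofReal (4 * (η s * Pf s) + η s * PV s + η s * Bb s + |deriv η s| * M s) := by
    rw [intervalIntegral.integral_of_le h1t]
    have hi₂ : IntegrableOn (fun s => 4 * (η s * Pf s) + η s * PV s + η s * Bb s + |deriv η s| * M s) (Ioc t₁ t) := by
      have := iR₂.1
      exact this
    rw [ofReal_integral_eq_lintegral_ofReal hi₂
      ((ae_restrict_iff' measurableSet_Ioc).2 (ae_of_all _ fun s hs => hR₂nn s ⟨hs.1.le, hs.2⟩))]
    exact lintegral_mono_set fun s hs => ⟨hs.1, lt_of_le_of_lt hs.2 ht⟩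
  -- nonnegativity of the good term
  have hGHnn : 0 ≤ ∫ s in t₁..t, η s * GH s := by
    refine intervalIntegral.integral_nonneg h1t fun s hs => mul_nonneg (hη0 s) ?_
    rw [hGH s]
    exact integral_nonneg fun x => mul_nonneg (mul_nonneg (hH2 _) (sq_nonneg _)) (sq_nonneg _)
  have hMnn : 0 ≤ η t * M t := by
    refine mul_nonneg (hη0 t) ?_
    rw [hM t]
    exact integral_nonneg fun x => mul_nonneg (hH0 _) (sq_nonneg _)
  refine ⟨?_, ?_⟩
  · refine (ENNReal.ofReal_le_ofReal ?_).trans hR₂le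
    linarith
  · refine (ENNReal.ofReal_le_ofReal ?_).trans hR₂le
    linarith

/-! ### The `L^{10/3}` step -/

/-- `‖r‖ₑ² = ofReal (r²)` for real `r`. [folklore] -/
private theorem enorm_sq_eq_ofReal_sq (r : ℝ) : ‖r‖ₑ ^ 2 = ENNReal.ofReal (r ^ 2) := by
  rw [Real.enorm_eq_ofReal_abs, ← ENNReal.ofReal_pow (abs_nonneg r), sq_abs]

/-- **The multiplicative inequality (2.4) of the Moser step for the swirl** (Seregin 2020,
arXiv p. 6: "Using the known multiplicative inequality `‖ψ²ω_N‖_{L_{10/3}(Q(r₁))} ≤ c|ψ²ω_N|_{2,Q(r₁)}`";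
Lei–Zhang 2011, p. 7). In the setting of `swirl_moser_energyClass_bounds`, with moreover
`H = s²` for an `s ∈ C¹` with `2s'² ≤ H''` and `η = χ²` for a `χ ∈ C¹`, the energy-class
function `g(t, x) = χ(t) Θ(x) s(σ(t, x))` satisfies
`∬_{]t₁,hi[×ℝ³} |g|^{10/3} ≤ C_S² ℛ^{2/3} (2ℛ + ℛ/2)`, `ℛ = ∫⁻_{]t₁,hi[}(4ηP + ηP_V + ηB_b + |η'|M)`
(`‖g(t)‖₂² = η M ≤ ℛ`, `‖∇g(t)‖₂² ≤ η(G_H + 2P)`, `∫ηG_H ≤ 2ℛ`, `∫2ηP ≤ ℛ/2`, and the tree's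
parabolic embedding `LeiZhang2011.lintegral_rpow_tenThirds_le_of_slice_bounds`).
[cite: Seregin2020, proof of Thm. 2.1, (2.4) (arXiv p. 6)] -/
theorem swirl_moser_tenThirds_le (hU : IsOpen U)
    (hSU : (S : Set (ℝ × EuclideanSpace ℝ (Fin 3))) = Ioo lo hi ×ˢ U)
    (hS : ∀ θ : ℝ, ∀ z ∈ (S : Set (ℝ × EuclideanSpace ℝ (Fin 3))), stRot θ z ∈ (S : Set (ℝ × EuclideanSpace ℝ (Fin 3))))
    (hUρ : ∀ x ∈ U, cylRadius x ≠ 0) (hV : IsSmoothAxisymmetricSolutionOn S V P)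
    {H sf : ℝ → ℝ} (hH : ContDiff ℝ 2 H) (hsf : ContDiff ℝ 1 sf) (hHs : ∀ v, H v = sf v ^ 2)
    (hs2 : ∀ v, 2 * deriv sf v ^ 2 ≤ deriv (deriv H) v)
    (hκ : ∀ v, deriv H v ^ 2 ≤ 2 * H v * deriv (deriv H) v)
    {Θ : EuclideanSpace ℝ (Fin 3) → ℝ} (hΘ : ContDiff ℝ 1 Θ) (hΘc : HasCompactSupport Θ)
    (hΘU : tsupport Θ ⊆ U) {η χ : ℝ → ℝ} (hη : ContDiff ℝ 1 η) (hηχ : ∀ s, η s = χ s ^ 2)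
    {t₁ : ℝ} (h1 : lo < t₁) (h1' : t₁ < hi) (hη1 : η t₁ = 0)
    {M GH Pf PV Bb : ℝ → ℝ}
    (hM : ∀ s, M s = ∫ x, H (swirl (V s) x) * Θ x ^ 2)
    (hGH : ∀ s, GH s = ∫ x, deriv (deriv H) (swirl (V s) x) * ‖gradient (swirl (V s)) x‖ ^ 2 * Θ x ^ 2)
    (hPf : ∀ s, Pf s = ∫ x, H (swirl (V s) x) * ‖gradient Θ x‖ ^ 2)
    (hPV : ∀ s, PV s = ∫ x, H (swirl (V s) x) * (‖V s x‖ * ‖gradient (fun y => Θ y ^ 2) x‖))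
    (hBb : ∀ s, Bb s = ∫ x, 2 / cylRadius x * (H (swirl (V s) x) * max (fderiv ℝ (fun y => Θ y ^ 2) x (eR x)) 0)) :
    ∫⁻ p, ‖χ p.1 * (Θ p.2 * sf (swirl (V p.1) p.2))‖ₑ ^ (10 / 3 : ℝ) ∂((volume.restrict (Ioo t₁ hi)).prod volume) ≤
      (SNormLESNormFDerivOfEqConst ℝ (volume : Measure (EuclideanSpace ℝ (Fin 3))) 2 : ℝ≥0∞) ^ 2 *
        (∫⁻ s in Ioo t₁ hi, ENNReal.ofReal (4 * (η s * Pf s) + η s * PV s + η s * Bb s + |deriv η s| * M s)) ^ (2 / 3 : ℝ) *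
        (2 * (∫⁻ s in Ioo t₁ hi, ENNReal.ofReal (4 * (η s * Pf s) + η s * PV s + η s * Bb s + |deriv η s| * M s)) +
          (∫⁻ s in Ioo t₁ hi, ENNReal.ofReal (4 * (η s * Pf s) + η s * PV s + η s * Bb s + |deriv η s| * M s)) / 2) := by
  -- abbreviations
  obtain ⟨R₂, hR₂⟩ : ∃ R₂ : ℝ → ℝ, ∀ s, R₂ s = 4 * (η s * Pf s) + η s * PV s + η s * Bb s + |deriv η s| * M s :=
    ⟨_, fun _ => rfl⟩
  set ℛ : ℝ≥0∞ := ∫⁻ s in Ioo t₁ hi, ENNReal.ofReal (4 * (η s * Pf s) + η s * PV s + η s * Bb s + |deriv η s| * M s) with hℛ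
  set ν : Measure ℝ := volume.restrict (Ioo t₁ hi) with hν
  -- nonnegativity and structure of `H`, `η`
  have hH0 : ∀ v, 0 ≤ H v := fun v => by rw [hHs v]; exact sq_nonneg _
  have hH2 : ∀ v, 0 ≤ deriv (deriv H) v := fun v =>
    (mul_nonneg zero_le_two (sq_nonneg _)).trans (hs2 v)
  have hη0 : ∀ s, 0 ≤ η s := fun s => by rw [hηχ s]; exact sq_nonneg _
  -- the energy class bounds at every time
  have hEC : ∀ t, t₁ ≤ t → t < hi → ENNReal.ofReal (η t * M t) ≤ ℛ ∧
      ENNReal.ofReal (1 / 2 * ∫ s in t₁..t, η s * GH s) ≤ ℛ := fun t h1t ht =>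
    swirl_moser_energyClass_bounds hU hSU hS hUρ hV hH hH0 hH2 hκ hΘ hΘc hΘU hη hη0 h1 hη1
      hM hGH hPf hPV hBb h1t ht
  -- regularity facts
  set K : Set (EuclideanSpace ℝ (Fin 3)) := tsupport Θ with hKdef
  have hK : IsCompact K := hΘc
  have hΘ0 : ∀ x, x ∉ K → Θ x = 0 := fun x hx => image_eq_zero_of_notMem_tsupport hx
  have hgΘ0' : ∀ x, x ∉ K → gradient Θ x = 0 := fun x hx => gradient_eq_zero_of_notMem_tsupport hx
  have hH' : ContDiff ℝ 1 (deriv H) := by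
    have h2' : ContDiff ℝ (1 + 1) H := by rw [one_add_one_eq_two]; exact hH
    exact h2'.deriv'
  have hIoo : Ioo t₁ hi ⊆ Ioo lo hi := fun s hs => ⟨h1.trans hs.1, hs.2⟩
  obtain ⟨T₁, hT₁⟩ : ∃ T₁ : ℝ → ℝ, ∀ s, T₁ s = ∫ x, deriv H (swirl (V s) x) *
      ⟪gradient (swirl (V s)) x, gradient (fun y => Θ y ^ 2) x⟫ := ⟨_, fun _ => rfl⟩
  obtain ⟨TV, hTV⟩ : ∃ TV : ℝ → ℝ, ∀ s, TV s = ∫ x, H (swirl (V s) x) * ⟪V s x, gradient (fun y => Θ y ^ 2) x⟫ :=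
    ⟨_, fun _ => rfl⟩
  obtain ⟨Tb, hTb⟩ : ∃ Tb : ℝ → ℝ, ∀ s, Tb s =
      ∫ x, 2 / cylRadius x * (H (swirl (V s) x) * fderiv ℝ (fun y => Θ y ^ 2) x (eR x)) := ⟨_, fun _ => rfl⟩
  obtain ⟨cM, cGH, -, cPf, -, -⟩ :=
    continuousOn_swirl_sliceFunctionals hU hSU hUρ hV hH hΘ hΘc hΘU hM hGH hT₁ hPf hTV hTb
  have cη : Continuous η := hη.continuous
  -- the energy-class function, slice by slice
  set g : ℝ → EuclideanSpace ℝ (Fin 3) → ℝ := fun s x => χ s * (Θ x * sf (swirl (V s) x)) with hg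
  have hgC : ∀ s ∈ Ioo t₁ hi, ContDiff ℝ 1 (g s) := by
    intro s hs
    have hF1 : ContDiffOn ℝ 1 (swirl (V s)) U := (contDiffOn_swirl_slice hSU hV (hIoo hs)).of_le (by norm_cast)
    exact contDiff_const.mul (contDiff_cutoff_smul_of_contDiffOn hU hΘ hΘU (hsf.comp_contDiffOn hF1))
  have hg0 : ∀ s x, x ∉ K → g s x = 0 := fun s x hx => by simp [hg, hΘ0 x hx]
  have hgcs : ∀ s, HasCompactSupport (g s) := fun s => HasCompactSupport.intro hK (hg0 s)
  have hgK : ∀ s, tsupport (g s) ⊆ K := fun s =>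
    closure_minimal (fun x hx => by by_contra h; exact hx (hg0 s x h)) hK.isClosed
  -- (1) slices are `C¹` and square integrable
  have hg_ae : ∀ᵐ s ∂ν, ContDiff ℝ 1 (g s) :=
    (ae_restrict_iff' measurableSet_Ioo).2 (ae_of_all _ fun s hs => hgC s hs)
  have hg2 : ∀ᵐ s ∂ν, eLpNorm (g s) 2 (volume : Measure (EuclideanSpace ℝ (Fin 3))) < (⊤ : ℝ≥0∞) :=
    (ae_restrict_iff' measurableSet_Ioo).2 (ae_of_all _ fun s hs =>
      ((hgC s hs).continuous.memLp_of_hasCompactSupport (hgcs s)).eLpNorm_lt_top)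
  -- (2) the `L²` slice bound `∫ g(s)² = η M ≤ ℛ`
  have hMst : ∀ᵐ s ∂ν, ∫⁻ x, ‖g s x‖ₑ ^ 2 ≤ ℛ := by
    refine (ae_restrict_iff' measurableSet_Ioo).2 (ae_of_all _ fun s hs => ?_)
    have hint : Integrable fun x => g s x ^ 2 :=
      ((hgC s hs).continuous.pow 2).integrable_of_hasCompactSupport
        (HasCompactSupport.intro hK fun x hx => by simp [hg0 s x hx])
    have e1 : ∫⁻ x, ‖g s x‖ₑ ^ 2 = ENNReal.ofReal (∫ x, g s x ^ 2) := by
      simp_rw [enorm_sq_eq_ofReal_sq]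
      rw [ofReal_integral_eq_lintegral_ofReal hint (ae_of_all _ fun x => sq_nonneg _)]
    have e2 : ∫ x, g s x ^ 2 = η s * M s := by
      rw [hM s, ← MeasureTheory.integral_const_mul]
      refine integral_congr_ae (ae_of_all _ fun x => ?_)
      simp only [hg, hHs, hηχ]
      ring
    rw [e1, e2]
    exact (hEC s hs.1.le hs.2).1
  -- (3) the gradient slice bound `∫ ‖∇g(s)‖² ≤ η(G_H + 2P)`
  set W : ℝ → ℝ≥0∞ := fun s => ENNReal.ofReal (η s * GH s + 2 * (η s * Pf s)) with hW
  have hWm : AEMeasurable W ν := by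
    have hc : ContinuousOn (fun s => η s * GH s + 2 * (η s * Pf s)) (Ioo t₁ hi) :=
      (cη.continuousOn.mul (cGH.mono hIoo)).add (continuousOn_const.mul (cη.continuousOn.mul (cPf.mono hIoo)))
    exact ENNReal.measurable_ofReal.comp_aemeasurable (hc.aemeasurable measurableSet_Ioo)
  have hWb : ∀ᵐ s ∂ν, ∫⁻ x, ‖fderiv ℝ (g s) x‖ₑ ^ 2 ≤ W s := by
    refine (ae_restrict_iff' measurableSet_Ioo).2 (ae_of_all _ fun s hs => ?_)
    have hsI : s ∈ Ioo lo hi := hIoo hs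
    have hF1 : ContDiffOn ℝ 1 (swirl (V s)) U := (contDiffOn_swirl_slice hSU hV hsI).of_le (by norm_cast)
    have cF : ContinuousOn (swirl (V s)) U := hF1.continuousOn
    have cgF : ContinuousOn (gradient (swirl (V s))) U := continuousOn_gradient_of_contDiffOn hU hF1
    have cΘ2 : Continuous fun y : EuclideanSpace ℝ (Fin 3) => Θ y ^ 2 := hΘ.continuous.pow 2
    have cgΘ : Continuous (gradient Θ) := continuous_gradient_of_contDiff hΘ
    -- pointwise bound
    have hpt : ∀ x, ‖fderiv ℝ (g s) x‖ ^ 2 ≤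
        η s * (deriv (deriv H) (swirl (V s) x) * ‖gradient (swirl (V s)) x‖ ^ 2 * Θ x ^ 2) +
          2 * (η s * (H (swirl (V s) x) * ‖gradient Θ x‖ ^ 2)) := by
      intro x
      by_cases hx : x ∈ K
      · have hxU : x ∈ U := hΘU hx
        have hFd : DifferentiableAt ℝ (swirl (V s)) x :=
          (hF1.differentiableOn one_ne_zero x hxU).differentiableAt (hU.mem_nhds hxU)
        have hΘd : DifferentiableAt ℝ Θ x := (hΘ.differentiable one_ne_zero) x
        have hin : DifferentiableAt ℝ (fun y => Θ y * sf (swirl (V s) y)) x :=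
          hΘd.mul (((hsf.differentiable one_ne_zero) _).comp x hFd)
        have e : fderiv ℝ (g s) x = χ s • fderiv ℝ (fun y => Θ y * sf (swirl (V s) y)) x := by
          simp only [hg]
          exact fderiv_const_mul hin (χ s)
        rw [e, norm_smul, mul_pow, Real.norm_eq_abs, sq_abs, ← hηχ]
        have h := norm_fderiv_mul_comp_sq_le_at hFd hΘd hsf hs2
        have := hη0 s
        calc η s * ‖fderiv ℝ (fun y => Θ y * sf (swirl (V s) y)) x‖ ^ 2
            ≤ η s * (deriv (deriv H) (swirl (V s) x) * ‖gradient (swirl (V s)) x‖ ^ 2 * Θ x ^ 2 +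
              2 * sf (swirl (V s) x) ^ 2 * ‖gradient Θ x‖ ^ 2) := mul_le_mul_of_nonneg_left h (hη0 s)
          _ = _ := by rw [← hHs]; ring
      · have h0 : fderiv ℝ (g s) x = 0 := fderiv_of_notMem_tsupport ℝ fun h => hx (hgK s h)
        rw [h0, norm_zero, hΘ0 x hx, hgΘ0' x hx, norm_zero]
        simp
    -- integrate
    have iA : Integrable fun x => deriv (deriv H) (swirl (V s) x) * ‖gradient (swirl (V s)) x‖ ^ 2 * Θ x ^ 2 :=
      (continuous_integrable_of_continuousOn_of_eq_zero hU hK hΘU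
        ((((hH'.continuous_deriv le_rfl).comp_continuousOn cF).mul (cgF.norm.pow 2)).mul cΘ2.continuousOn)
        (fun x hx => by simp [hΘ0 x hx])).2
    have iB : Integrable fun x => H (swirl (V s) x) * ‖gradient Θ x‖ ^ 2 :=
      (continuous_integrable_of_continuousOn_of_eq_zero hU hK hΘU
        ((hH.continuous.comp_continuousOn cF).mul (cgΘ.norm.pow 2).continuousOn)
        (fun x hx => by simp [hgΘ0' x hx])).2
    have iRHS : Integrable fun x => η s * (deriv (deriv H) (swirl (V s) x) * ‖gradient (swirl (V s)) x‖ ^ 2 * Θ x ^ 2) +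
        2 * (η s * (H (swirl (V s) x) * ‖gradient Θ x‖ ^ 2)) :=
      (iA.const_mul _).add ((iB.const_mul _).const_mul _)
    have hRHSnn : ∀ x, 0 ≤ η s * (deriv (deriv H) (swirl (V s) x) * ‖gradient (swirl (V s)) x‖ ^ 2 * Θ x ^ 2) +
        2 * (η s * (H (swirl (V s) x) * ‖gradient Θ x‖ ^ 2)) := fun x => by
      have := hη0 s; have := hH2 (swirl (V s) x); have := hH0 (swirl (V s) x)
      positivity
    have eRHS : ∫ x, (η s * (deriv (deriv H) (swirl (V s) x) * ‖gradient (swirl (V s)) x‖ ^ 2 * Θ x ^ 2) +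
        2 * (η s * (H (swirl (V s) x) * ‖gradient Θ x‖ ^ 2))) = η s * GH s + 2 * (η s * Pf s) := by
      rw [integral_add (iA.const_mul _) ((iB.const_mul _).const_mul _), MeasureTheory.integral_const_mul,
        MeasureTheory.integral_const_mul, MeasureTheory.integral_const_mul, ← hGH s, ← hPf s]
    calc ∫⁻ x, ‖fderiv ℝ (g s) x‖ₑ ^ 2 = ∫⁻ x, ENNReal.ofReal (‖fderiv ℝ (g s) x‖ ^ 2) := by
          refine lintegral_congr fun x => ?_
          rw [← enorm_norm, enorm_sq_eq_ofReal_sq]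
      _ ≤ ∫⁻ x, ENNReal.ofReal (η s * (deriv (deriv H) (swirl (V s) x) * ‖gradient (swirl (V s)) x‖ ^ 2 * Θ x ^ 2) +
            2 * (η s * (H (swirl (V s) x) * ‖gradient Θ x‖ ^ 2))) :=
          lintegral_mono fun x => ENNReal.ofReal_le_ofReal (hpt x)
      _ = ENNReal.ofReal (η s * GH s + 2 * (η s * Pf s)) := by
          rw [← ofReal_integral_eq_lintegral_ofReal iRHS (ae_of_all _ hRHSnn), eRHS]
  -- (4) the parabolic embedding
  have hemb := lintegral_rpow_tenThirds_le_of_slice_bounds (ν := ν) hg_ae hg2 hMst hWm hWb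
  -- (5) `∫⁻ W ≤ 2ℛ + ℛ/2`
  have hR₂nn : ∀ s ∈ Ioo t₁ hi, 0 ≤ 4 * (η s * Pf s) + η s * PV s + η s * Bb s + |deriv η s| * M s ∧
      2 * (η s * Pf s) ≤ (4 * (η s * Pf s) + η s * PV s + η s * Bb s + |deriv η s| * M s) / 2 := by
    intro s hs
    have hPf0 : 0 ≤ Pf s := by
      rw [hPf s]
      exact integral_nonneg fun x => mul_nonneg (hH0 _) (sq_nonneg _)
    have hPV0 : 0 ≤ PV s := by
      rw [hPV s]
      exact integral_nonneg fun x => mul_nonneg (hH0 _) (mul_nonneg (norm_nonneg _) (norm_nonneg _))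
    have hBb0 : 0 ≤ Bb s := by
      rw [hBb s]
      exact integral_nonneg fun x => mul_nonneg (div_nonneg zero_le_two (cylRadius_nonneg x))
        (mul_nonneg (hH0 _) (le_max_right _ _))
    have hM0 : 0 ≤ M s := by
      rw [hM s]
      exact integral_nonneg fun x => mul_nonneg (hH0 _) (sq_nonneg _)
    have hη0s := hη0 s
    have h1 : 0 ≤ η s * PV s := mul_nonneg hη0s hPV0
    have h2 : 0 ≤ η s * Bb s := mul_nonneg hη0s hBb0
    have h3 : 0 ≤ |deriv η s| * M s := mul_nonneg (abs_nonneg _) hM0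
    have h4 : 0 ≤ η s * Pf s := mul_nonneg hη0s hPf0
    exact ⟨by positivity, by linarith⟩
  have hWle : ∫⁻ s, W s ∂ν ≤ 2 * ℛ + ℛ / 2 := by
    -- split `W`
    have hsplit : ∫⁻ s, W s ∂ν = (∫⁻ s in Ioo t₁ hi, ENNReal.ofReal (η s * GH s)) +
        ∫⁻ s in Ioo t₁ hi, ENNReal.ofReal (2 * (η s * Pf s)) := by
      rw [hν, ← lintegral_add_left']
      · refine setLIntegral_congr_fun measurableSet_Ioo fun s hs => ?_
        simp only [hW]
        rw [ENNReal.ofReal_add]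
        · refine mul_nonneg (hη0 s) ?_
          rw [hGH s]
          exact integral_nonneg fun x => mul_nonneg (mul_nonneg (hH2 _) (sq_nonneg _)) (sq_nonneg _)
        · exact mul_nonneg zero_le_two (mul_nonneg (hη0 s) (by
            rw [hPf s]; exact integral_nonneg fun x => mul_nonneg (hH0 _) (sq_nonneg _)))
      · exact ENNReal.measurable_ofReal.comp_aemeasurable
          ((cη.continuousOn.mul (cGH.mono hIoo)).aemeasurable measurableSet_Ioo)
    -- the good term: monotone limit of the bounds on `[t₁, t]`
    have hGHle : ∫⁻ s in Ioo t₁ hi, ENNReal.ofReal (η s * GH s) ≤ 2 * ℛ := by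
      -- an increasing sequence of right end points
      set c : ℕ → ℝ := fun n => hi - (hi - t₁) / (n + 2) with hc
      have hc1 : ∀ n, t₁ < c n := by
        intro n
        rw [hc]
        have hn : (2 : ℝ) ≤ n + 2 := by
          have : (0 : ℝ) ≤ n := Nat.cast_nonneg n
          linarith
        have hd : 0 < hi - t₁ := sub_pos.2 h1'
        have : (hi - t₁) / (n + 2) ≤ (hi - t₁) / 2 := div_le_div_of_nonneg_left hd.le (by norm_num) hn
        linarith
      have hc2 : ∀ n, c n < hi := by
        intro n
        rw [hc]
        have hd : 0 < hi - t₁ := sub_pos.2 h1'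
        have : 0 < (hi - t₁) / (n + 2) := div_pos hd (by positivity)
        linarith
      have hcmono : Monotone c := by
        intro a b hab
        simp only [hc]
        have hd : 0 < hi - t₁ := sub_pos.2 h1'
        have hab' : (a : ℝ) + 2 ≤ b + 2 := by exact_mod_cast Nat.add_le_add_right hab 2
        have := div_le_div_of_nonneg_left hd.le (by positivity : (0 : ℝ) < a + 2) hab'
        linarith
      have hunion : Ioo t₁ hi = ⋃ n, Ioc t₁ (c n) := by
        ext s
        simp only [mem_iUnion, mem_Ioo, mem_Ioc]
        constructor
        · rintro ⟨hs1, hs2⟩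
          have hd : 0 < hi - s := sub_pos.2 hs2
          obtain ⟨n, hn⟩ := exists_nat_gt ((hi - t₁) / (hi - s))
          refine ⟨n, hs1, ?_⟩
          rw [hc]
          have hn2 : (hi - t₁) / (hi - s) < n + 2 := by linarith
          have h3 : (hi - t₁) / ((n : ℝ) + 2) < hi - s := by
            rw [div_lt_iff₀ (by positivity)]
            rw [div_lt_iff₀ hd] at hn2
            linarith
          linarith
        · rintro ⟨n, hs1, hs2⟩
          exact ⟨hs1, lt_of_le_of_lt hs2 (hc2 n)⟩
      have hdir : Directed (· ⊆ ·) fun n => Ioc t₁ (c n) :=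
        Monotone.directed_le fun a b hab => Ioc_subset_Ioc le_rfl (hcmono hab)
      rw [hunion, setLIntegral_iUnion_of_directed _ hdir]
      refine iSup_le fun n => ?_
      -- on `(t₁, c n]` the set integral is `ofReal ∫_{t₁}^{c n} ηGH ≤ 2ℛ`
      have hIcc : Icc t₁ (c n) ⊆ Ioo lo hi := fun r hr => ⟨lt_of_lt_of_le h1 hr.1, lt_of_le_of_lt hr.2 (hc2 n)⟩
      have hii : IntervalIntegrable (fun s => η s * GH s) volume t₁ (c n) := by
        refine (ContinuousOn.intervalIntegrable ?_)
        rw [uIcc_of_le (hc1 n).le]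
        exact (cη.continuousOn.mul (cGH.mono hIcc))
      have hnn : ∀ s ∈ Icc t₁ (c n), 0 ≤ η s * GH s := fun s _ => mul_nonneg (hη0 s) (by
        rw [hGH s]; exact integral_nonneg fun x => mul_nonneg (mul_nonneg (hH2 _) (sq_nonneg _)) (sq_nonneg _))
      have e : ∫⁻ s in Ioc t₁ (c n), ENNReal.ofReal (η s * GH s) = ENNReal.ofReal (∫ s in t₁..c n, η s * GH s) := by
        rw [intervalIntegral.integral_of_le (hc1 n).le,
          ofReal_integral_eq_lintegral_ofReal hii.1
            ((ae_restrict_iff' measurableSet_Ioc).2 (ae_of_all _ fun s hs => hnn s ⟨hs.1.le, hs.2⟩))]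
      rw [e]
      have h2 := (hEC (c n) (hc1 n).le (hc2 n)).2
      have hI0 : 0 ≤ ∫ s in t₁..c n, η s * GH s := intervalIntegral.integral_nonneg (hc1 n).le hnn
      calc ENNReal.ofReal (∫ s in t₁..c n, η s * GH s)
          = 2 * ENNReal.ofReal (1 / 2 * ∫ s in t₁..c n, η s * GH s) := by
            rw [← ENNReal.ofReal_ofNat 2, ← ENNReal.ofReal_mul (by norm_num)]
            congr 1
            ring
        _ ≤ 2 * ℛ := mul_le_mul_right h2 2
    -- the cut-off term: pointwise domination
    have hPfle : ∫⁻ s in Ioo t₁ hi, ENNReal.ofReal (2 * (η s * Pf s)) ≤ ℛ / 2 := by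
      have hmono : ∫⁻ s in Ioo t₁ hi, ENNReal.ofReal (2 * (η s * Pf s)) ≤
          ∫⁻ s in Ioo t₁ hi, ENNReal.ofReal (4 * (η s * Pf s) + η s * PV s + η s * Bb s + |deriv η s| * M s) / 2 := by
        refine setLIntegral_mono' measurableSet_Ioo fun s hs => ?_
        obtain ⟨hnn, hle⟩ := hR₂nn s hs
        rw [ENNReal.le_div_iff_mul_le (Or.inl two_ne_zero) (Or.inl ENNReal.ofNat_ne_top),
          ← ENNReal.ofReal_ofNat 2, ← ENNReal.ofReal_mul' (by norm_num)]
        exact ENNReal.ofReal_le_ofReal (by linarith)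
      refine hmono.trans (le_of_eq ?_)
      simp_rw [ENNReal.div_eq_inv_mul]
      rw [← lintegral_const_mul' _ _ (by simp)]
    rw [hsplit]
    exact add_le_add hGHle hPfle
  -- (6) conclusion
  calc ∫⁻ p, ‖χ p.1 * (Θ p.2 * sf (swirl (V p.1) p.2))‖ₑ ^ (10 / 3 : ℝ) ∂(ν.prod volume)
      = ∫⁻ p, ‖g p.1 p.2‖ₑ ^ (10 / 3 : ℝ) ∂(ν.prod volume) := rfl
    _ ≤ (SNormLESNormFDerivOfEqConst ℝ (volume : Measure (EuclideanSpace ℝ (Fin 3))) 2 : ℝ≥0∞) ^ 2 *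
          ℛ ^ (2 / 3 : ℝ) * ∫⁻ s, W s ∂ν := hemb
    _ ≤ (SNormLESNormFDerivOfEqConst ℝ (volume : Measure (EuclideanSpace ℝ (Fin 3))) 2 : ℝ≥0∞) ^ 2 *
          ℛ ^ (2 / 3 : ℝ) * (2 * ℛ + ℛ / 2) := mul_le_mul_right hWle _

end Seregin2020

end Literature.Analysis.FluidPDE
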